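import Summits.QuantumFields.BalabanUV.T4Continuum.Support.NE7K1LinSchurBilinError

/-!
# NE7K1LinSchurSizes — row NE7 (node U5), candidate route HOM, path H1L, cell K1-lin(s), (π6): the Schur member's bilinear error WITH
# THE SIZES BOUNDED (`e ≥ √(1 + a₀∕d₀)`, `q ≥ 1∕√d₀`) and the explicit MESH-FREE constants of the U = 1 weighted letter

Lineage `b2b-balaban-t4-ne7-p2` (CRUX PROVER NE7 #2), generation 64; kit for `NE7K1LinSchurLineDerivU1W`.  [folklore]:
* **`schur_bound_of_sizes`**: `|⟨z,(conjW ρ_c S)u⟩ − ⟨z,Su⟩| ≤ κ((e + xq) + e(1 + x) + e(e + xq))·(√E_S(z) + ‖z‖)(√E_S(u) + ‖u‖)`,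
  `x = 2κ((1+q)e + q)` — `NE7K1LinSchurBilinError.bilin_conjError_schur_le` with every size replaced by an upper bound, so that at
  U = 1 (`d₀ = 2n²∕L^{d+1}`, `a₀ = L²(4(d+1)n² + a)`) the mesh-free `q = √(L^{d+1}∕2)`, `e = √(1 + L^{d+3}(4(d+1)+a)∕2)` enter;
* `kappaH` (run B's bilinear constant), `schurConst`, **`kappaU1W`** (the two-cutoff line's four-term bilinear constant) — closed
  expressions in `d, L, a, δ, Θ` with NO `n` — and their nonnegativity.

HONEST FRAMING: [folklore]; nothing printed asserted; no `sorry`.  FIXED FINITE T⁴, rung (B)+1; NE7 NOT PRINTED ∕ NOT PROVED; spine 0∕9;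
NOT infinite volume, NOT mass gap, NOT Clay.  HONEST DEPENDENCY: continuum YM on T⁴ ⇐ BetaPertH ∧ nine spine estimates (0/9 proved);
BetaPertH ⇐ (D1) ∧ (D4) ∧ CAP+tail; G-an2-4 gates asym, D1 and NE2/3/4.
-/

noncomputable section

open Finset Matrix

namespace Summit.QuantumFields.BalabanUV.T4Continuum.NE7K1LinSchurSizes

open NE7K1LinSchurLineForm NE7K1LinSchurLineDerivRel NE7K1LinConjW NE7K1LinSchurHarmonicExt NE7K1LinSchurBilinError

/-! ### §1 Abstract: the Schur member's bilinear error with the sizes replaced by bounds -/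

section Abstract

variable {ιc ιf : Type*} [Fintype ιc] [Fintype ιf] [DecidableEq ιf]

/-- **`bilin_conjError_schur_le` WITH THE SIZES BOUNDED**: if `√(1 + a₀∕d₀) ≤ e` and `1∕√d₀ ≤ q` then
`|⟨z,(conjW ρ_c S)u⟩ − ⟨z,Su⟩| ≤ C·(√E_S(z) + ‖z‖)·(√E_S(u) + ‖u‖)` with `C = κ((e + xq) + e(1 + x) + e(e + xq))`,
`x = 2κ((1+q)e + q)`. [folklore] -/
theorem schur_bound_of_sizes (H : Matrix (ιc ⊕ ιf) (ιc ⊕ ιf) ℝ) (hHs : H.IsSymm) (ρ : ιc ⊕ ιf → ℝ) {σ κ d₀ a₀ e q : ℝ}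
    (hσ : 0 < σ) (hκ : 0 ≤ κ) (hd₀ : 0 < d₀)
    (hH : ∀ v, σ * (v ⬝ᵥ v) ≤ v ⬝ᵥ H.mulVec v)
    (herr : ∀ v, -(σ / 2) * (v ⬝ᵥ v) ≤ v ⬝ᵥ (conjW ρ H).mulVec v - v ⬝ᵥ H.mulVec v)
    (hb : ∀ v v', |v ⬝ᵥ (conjW ρ H).mulVec v' - v ⬝ᵥ H.mulVec v'| ≤
      κ * (Real.sqrt (v ⬝ᵥ H.mulVec v) * Real.sqrt (v' ⬝ᵥ v') + Real.sqrt (v ⬝ᵥ v) * Real.sqrt (v' ⬝ᵥ H.mulVec v') +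
        Real.sqrt (v ⬝ᵥ v) * Real.sqrt (v' ⬝ᵥ v')))
    (hd : ∀ ψ : ιf → ℝ, d₀ * (ψ ⬝ᵥ ψ) ≤ Sum.elim 0 ψ ⬝ᵥ H.mulVec (Sum.elim 0 ψ)) (ha₀ : 0 ≤ a₀)
    (ha : ∀ z : ιc → ℝ, Sum.elim z 0 ⬝ᵥ H.mulVec (Sum.elim z 0) ≤ a₀ * (z ⬝ᵥ z))
    (he : Real.sqrt (1 + a₀ / d₀) ≤ e) (hq : 1 / Real.sqrt d₀ ≤ q) (z u : ιc → ℝ) :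
    |z ⬝ᵥ (conjW (ρ ∘ Sum.inl) (schur H)).mulVec u - z ⬝ᵥ (schur H).mulVec u| ≤
      κ * ((e + 2 * κ * ((1 + q) * e + q) * q) + e * (1 + 2 * κ * ((1 + q) * e + q)) +
          e * (e + 2 * κ * ((1 + q) * e + q) * q)) *
        ((Real.sqrt (z ⬝ᵥ (schur H).mulVec z) + Real.sqrt (z ⬝ᵥ z)) *
          (Real.sqrt (u ⬝ᵥ (schur H).mulVec u) + Real.sqrt (u ⬝ᵥ u))) := by
  have h := bilin_conjError_schur_le H hHs ρ hσ hκ hd₀ hH herr hb hd ha₀ ha z u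
  refine h.trans ?_
  -- atoms and their bounds
  set Ez := Real.sqrt (z ⬝ᵥ (schur H).mulVec z)
  set Eu := Real.sqrt (u ⬝ᵥ (schur H).mulVec u)
  set Nz := Real.sqrt (z ⬝ᵥ z)
  set Nu := Real.sqrt (u ⬝ᵥ u)
  set e₀ := Real.sqrt (1 + a₀ / d₀)
  set q₀ := 1 / Real.sqrt d₀ with hq₀
  set x := 2 * κ * ((1 + q) * e + q) with hx
  have hEz : 0 ≤ Ez := Real.sqrt_nonneg _
  have hEu : 0 ≤ Eu := Real.sqrt_nonneg _
  have hNz : 0 ≤ Nz := Real.sqrt_nonneg _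
  have hNu : 0 ≤ Nu := Real.sqrt_nonneg _
  have he₀ : 0 ≤ e₀ := Real.sqrt_nonneg _
  have hq₀0 : 0 ≤ q₀ := by positivity
  have he0 : 0 ≤ e := he₀.trans he
  have hq0 : 0 ≤ q := hq₀0.trans hq
  have hx0 : 0 ≤ x := by positivity
  set Sz := Ez + Nz with hSz
  set Su := Eu + Nu with hSu
  have hSz0 : 0 ≤ Sz := by positivity
  have hSu0 : 0 ≤ Su := by positivity
  have hEzS : Ez ≤ Sz := by linarith
  have hNzS : Nz ≤ Sz := by linarith
  have hEuS : Eu ≤ Su := by linarith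
  have hNuS : Nu ≤ Su := by linarith
  -- the correction size `X ≤ x·Su`
  set X := 2 * (κ * ((1 + 1 / Real.sqrt d₀) * (Real.sqrt (1 + a₀ / d₀) * Nu) + 1 / Real.sqrt d₀ * Eu)) with hX
  have hX0 : 0 ≤ X := by positivity
  have hXle : X ≤ x * Su := by
    have a1 : (1 + 1 / Real.sqrt d₀) * (Real.sqrt (1 + a₀ / d₀) * Nu) ≤ (1 + q) * (e * Su) :=
      mul_le_mul (by linarith) (mul_le_mul he hNuS hNu he0) (by positivity) (by positivity)
    have a2 : 1 / Real.sqrt d₀ * Eu ≤ q * Su := mul_le_mul hq hEuS hEu hq0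
    have a3 : κ * ((1 + 1 / Real.sqrt d₀) * (Real.sqrt (1 + a₀ / d₀) * Nu) + 1 / Real.sqrt d₀ * Eu) ≤
        κ * ((1 + q) * (e * Su) + q * Su) := mul_le_mul_of_nonneg_left (add_le_add a1 a2) hκ
    calc X ≤ 2 * (κ * ((1 + q) * (e * Su) + q * Su)) := by rw [hX]; linarith
      _ = x * Su := by rw [hx]; ring
  have hXq : X / Real.sqrt d₀ ≤ x * Su * q := by
    rw [div_eq_mul_one_div]
    exact mul_le_mul hXle hq hq₀0 (by positivity)
  -- the three products
  have T1 : Ez * (e₀ * Nu + X / Real.sqrt d₀) ≤ Sz * (e * Su + x * Su * q) :=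
    mul_le_mul hEzS (add_le_add (mul_le_mul he hNuS hNu he0) hXq) (by positivity) hSz0
  have T2 : e₀ * Nz * (Eu + X) ≤ e * Sz * (Su + x * Su) :=
    mul_le_mul (mul_le_mul he hNzS hNz he0) (add_le_add hEuS hXle) (by positivity) (by positivity)
  have T3 : e₀ * Nz * (e₀ * Nu + X / Real.sqrt d₀) ≤ e * Sz * (e * Su + x * Su * q) :=
    mul_le_mul (mul_le_mul he hNzS hNz he0) (add_le_add (mul_le_mul he hNuS hNu he0) hXq) (by positivity) (by positivity)
  calc κ * (Ez * (e₀ * Nu + X / Real.sqrt d₀) + e₀ * Nz * (Eu + X) + e₀ * Nz * (e₀ * Nu + X / Real.sqrt d₀))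
      ≤ κ * (Sz * (e * Su + x * Su * q) + e * Sz * (Su + x * Su) + e * Sz * (e * Su + x * Su * q)) :=
        mul_le_mul_of_nonneg_left (add_le_add (add_le_add T1 T2) T3) hκ
    _ = κ * ((e + x * q) + e * (1 + x) + e * (e + x * q)) * (Sz * Su) := by ring
    _ = _ := by rw [hx]

end Abstract

/-! ### §2 The explicit mesh-free constants -/

section Consts

/-- run B's bilinear constant `κ_H = κ′ + κ″` (no `n`). [folklore] -/
def kappaH (d L : ℕ) (a δ Θ : ℝ) : ℝ :=
  ((L : ℝ) ^ (d + 1))⁻¹ * Real.sqrt (2 * (2 * ((d : ℝ) + 1) * (δ * L) ^ 2)) * Real.sqrt ((L : ℝ) ^ (d + 1) + 1) *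
      Real.sqrt ((L : ℝ) ^ (d + 1)) +
    ((L : ℝ) ^ (d + 1))⁻¹ * (2 * ((d : ℝ) + 1) * (δ * L) ^ 2 + a * (Real.exp Θ - 1)) * ((L : ℝ) ^ (d + 1) + 1)

/-- the Schur member's constant `C_S = κ_H((e + xq) + e(1 + x) + e(e + xq))·L²` with the mesh-free sizes
`e = √(1 + L^{d+3}(4(d+1)+a)∕2)`, `q = √(L^{d+1}∕2)`, `x = 2κ_H((1+q)e + q)` (no `n`). [folklore] -/
def schurConst (d L : ℕ) (a δ Θ : ℝ) : ℝ :=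
  kappaH d L a δ Θ *
      ((Real.sqrt (1 + (L : ℝ) ^ (d + 3) * (4 * ((d : ℝ) + 1) + a) / 2) +
          2 * kappaH d L a δ Θ * ((1 + Real.sqrt ((L : ℝ) ^ (d + 1) / 2)) *
            Real.sqrt (1 + (L : ℝ) ^ (d + 3) * (4 * ((d : ℝ) + 1) + a) / 2) + Real.sqrt ((L : ℝ) ^ (d + 1) / 2)) *
            Real.sqrt ((L : ℝ) ^ (d + 1) / 2)) +
        Real.sqrt (1 + (L : ℝ) ^ (d + 3) * (4 * ((d : ℝ) + 1) + a) / 2) *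
          (1 + 2 * kappaH d L a δ Θ * ((1 + Real.sqrt ((L : ℝ) ^ (d + 1) / 2)) *
            Real.sqrt (1 + (L : ℝ) ^ (d + 3) * (4 * ((d : ℝ) + 1) + a) / 2) + Real.sqrt ((L : ℝ) ^ (d + 1) / 2))) +
        Real.sqrt (1 + (L : ℝ) ^ (d + 3) * (4 * ((d : ℝ) + 1) + a) / 2) *
          (Real.sqrt (1 + (L : ℝ) ^ (d + 3) * (4 * ((d : ℝ) + 1) + a) / 2) +
            2 * kappaH d L a δ Θ * ((1 + Real.sqrt ((L : ℝ) ^ (d + 1) / 2)) *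
              Real.sqrt (1 + (L : ℝ) ^ (d + 3) * (4 * ((d : ℝ) + 1) + a) / 2) + Real.sqrt ((L : ℝ) ^ (d + 1) / 2)) *
              Real.sqrt ((L : ℝ) ^ (d + 1) / 2))) *
    (L : ℝ) ^ 2

/-- **THE MESH-FREE BILINEAR CONSTANT `κ` OF THE TWO-CUTOFF LINE**: run A's `√(2·2(d+1)δ²) + (2(d+1)δ² + a(e^Θ−1))` plus the Schur
member's `schurConst` (no `n`). [folklore] -/
def kappaU1W (d L : ℕ) (a δ Θ : ℝ) : ℝ :=
  Real.sqrt (2 * (2 * ((d : ℝ) + 1) * δ ^ 2)) + (2 * ((d : ℝ) + 1) * δ ^ 2 + a * (Real.exp Θ - 1)) + schurConst d L a δ Θ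

/-- `0 ≤ kappaH` (`a, Θ ≥ 0`). [folklore] -/
theorem kappaH_nonneg (d L : ℕ) {a δ Θ : ℝ} (ha : 0 ≤ a) (hΘ : 0 ≤ Θ) : 0 ≤ kappaH d L a δ Θ := by
  have hexp : 0 ≤ Real.exp Θ - 1 := by linarith [Real.add_one_le_exp Θ]
  unfold kappaH
  have : 0 ≤ 2 * ((d : ℝ) + 1) * (δ * L) ^ 2 + a * (Real.exp Θ - 1) := by nlinarith [mul_nonneg ha hexp, sq_nonneg (δ * L)]
  positivity

/-- `0 ≤ schurConst` (`a, Θ ≥ 0`). [folklore] -/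
theorem schurConst_nonneg (d L : ℕ) {a δ Θ : ℝ} (ha : 0 ≤ a) (hΘ : 0 ≤ Θ) : 0 ≤ schurConst d L a δ Θ := by
  have hk := kappaH_nonneg d L ha hΘ (δ := δ)
  unfold schurConst
  positivity

/-- `0 ≤ kappaU1W` (`a, Θ ≥ 0`). [folklore] -/
theorem kappaU1W_nonneg (d L : ℕ) {a δ Θ : ℝ} (ha : 0 ≤ a) (hΘ : 0 ≤ Θ) : 0 ≤ kappaU1W d L a δ Θ := by
  have hexp : 0 ≤ Real.exp Θ - 1 := by linarith [Real.add_one_le_exp Θ]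
  have hs := schurConst_nonneg d L ha hΘ (δ := δ)
  unfold kappaU1W
  have : 0 ≤ 2 * ((d : ℝ) + 1) * δ ^ 2 + a * (Real.exp Θ - 1) := by nlinarith [mul_nonneg ha hexp, sq_nonneg δ]
  positivity

end Consts

end Summit.QuantumFields.BalabanUV.T4Continuum.NE7K1LinSchurSizes
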